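import Summits.CriticalPhenomena.PercolationContinuityZ3.Theorems.PercNearOneGluingNoHeavyLowerTailSahiCombCore
import Summits.CriticalPhenomena.PercolationContinuityZ3.Theorems.PercNearOneGluingNoHeavyLowerTailSahiConjectureCubeFour

/-!
# The comb (tensor-Bernstein) hierarchy for Sahi's `E_k`, XVII (computational companion): Sahi's conjecture at EVERY order for families with a core of
# at most FOUR coordinates, and on the monotone algebra generated by four independent events

Support file of the one-cut programme (crux `NoHeavyLowerTail`, stmt-CriticalPhenomena-4575; cell `prim-masterthm`, seat P3, gen 3;
`run/shared/lean/prim/prim-masterthm/prim-masterthm-p3/HIERARCHY.md` §10).  COMPUTATIONAL: the base theorem is l12-p5's **Sahi conjecture at every order on four coins**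
(`NCopyCert.sahiE_ind_nonneg_of_isUpperSet_card_le_four`, seven `native_decide` certificates), transported by this seat's structural theorems
(`…SahiCombReadOnce`: read-once substitution; `…SahiCombPrivate` / `…SahiCombCore`: private-coordinate elimination and the cube transport).  Law level throughout.
* `sahiE_readOnce_nonneg_card_le_four` — **`E_n(μ_q) ≥ 0` for every `n` and every family of `n` events in the monotone algebra generated by at most four independent
  events** (gadgets `G e`, `|κ| ≤ 4`, determined by the disjoint fibres of `π : ι → κ`; not necessarily monotone);
* **`sahiE_ind_nonneg_of_core_le_four`** — **`E_n(μ_q) ≥ 0` for every `n` and every family of increasing events of a finite cube whose pairwise-shared coordinates lie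
  in a set `S` of size `≤ 4`** (every other coordinate private to one member; no bound on the number of coordinates or members).
So Sahi's Conjecture 5 / Lieb–Sahi Conjecture 1.1 holds, for product measures, on every family built from a 4-coordinate core by attaching arbitrary private
structure to each member.  HONEST FRAMING: nothing here asserts (M⁺-k) or `C_k` for `k ≥ 3` in general. [this work]
-/

noncomputable section

open scoped Classical

namespace Summit.CriticalPhenomena.PercolationContinuityZ3.Theorems

open Finset Function MeasureTheory
open Literature.Combinatorics.Sahi2008
open Literature.Probability.LatticeModels (prodBernoulli)
open Literature.Probability.LatticeModels.Kahn2022 (Affects)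
open Literature.Probability.Percolation (DeterminedBy determinedBy_iff)
open Literature.Probability.Percolation.DecisionTree (ind ind_of_mem ind_of_not_mem ind_nonneg)
open Literature.Probability.Percolation.BHK2006 (weight)
open SahiComb SahiCombReadOnce SahiCombPrivate SahiCombCore

namespace SahiCombCore

variable {ι : Type} [Fintype ι]

/-- **Sahi's conjecture at EVERY order on the monotone algebra generated by at most FOUR independent events** (law level): for a finite index type `κ` with
`|κ| ≤ 4`, gadgets `G e` determined by the fibres of `π : ι → κ`, any `n`, increasing `U_0,…,U_{n-1} ⊆ 2^κ` and every product measure `μ_q` on `2^ι`: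
`0 ≤ E_n(μ_q; 1_{U_0∘G},…,1_{U_{n-1}∘G})`. [this work] -/
theorem sahiE_readOnce_nonneg_card_le_four {κ : Type} [Fintype κ] (hκ : Fintype.card κ ≤ 4) (q : ι → unitInterval) (π : ι → κ)
    (G : κ → Set (Set ι)) (hG : ∀ e, DeterminedBy (G e) {i | π i = e}) {n : ℕ} (U : Fin n → Set (Set κ)) (hU : ∀ j, IsUpperSet (U j)) :
    0 ≤ sahiE (bernoulliWeight q) n (fun j => ind {ω : Set ι | {e | ω ∈ G e} ∈ U j}) := by
  let c : κ → unitInterval := fun e => ⟨(prodBernoulli q).real (G e), measureReal_nonneg, measureReal_le_one⟩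
  have hw : (weight fun e => (prodBernoulli q).real (G e)) = bernoulliWeight c := rfl
  rw [sahiE_readOnce_eq π G hG q U, hw]
  exact NCopyCert.sahiE_ind_nonneg_of_isUpperSet_card_le_four hκ c n U hU

/-- **SAHI'S CONJECTURE AT EVERY ORDER FOR FAMILIES WITH A CORE OF AT MOST FOUR COORDINATES** (law level): increasing events `U_0,…,U_n` of a finite cube, a set `S` of
at most four coordinates such that every coordinate outside `S` affects at most one member ⇒ `E_{n+1}(μ_q; 1_U) ≥ 0` for every product measure. [this work] -/
theorem sahiE_ind_nonneg_of_core_le_four (S : Finset ι) (hS4 : S.card ≤ 4) {n : ℕ} (U : Fin (n + 1) → Set (Set ι)) (hU : ∀ j, IsUpperSet (U j))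
    (hpriv : ∀ e, e ∉ S → ∀ j j', Affects (U j) e → Affects (U j') e → j = j') (q : ι → unitInterval) :
    0 ≤ sahiE (bernoulliWeight q) (n + 1) (fun j => ind (U j)) :=
  sahiE_ind_nonneg_of_core' S (fun V hVu hVd c => nonneg_of_determinedBy_of_cube S
    (fun W hW c' => NCopyCert.sahiE_ind_nonneg_of_isUpperSet_card_le_four (by rw [Fintype.card_coe]; exact hS4) c' (n + 1) W hW) V hVu hVd c)
    U hU hpriv q

end SahiCombCore

end Summit.CriticalPhenomena.PercolationContinuityZ3.Theorems

end
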